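import Summits.QuantumFields.YangMills.Theorems.FlatTubeReductionFibreMassPointwise
import Summits.QuantumFields.YangMills.Theorems.FlatTubeReductionFPWeightPointwiseEventually
import Summits.QuantumFields.YangMills.Theorems.FlatTubeReductionFibreMassRecordNumerology
import HarnessLib

/-!
# The fibre mass POINTWISE AT RATE for the record weight `recordChi L (1/6) (42D+1) M`: `|mass_β(u) − γ_β| ≤ (κ_N·orbitDist(u)² + aλ_b(L³β)²)·γ_β` and
# `|mass_β(u)/mass_β(1) − 1| ≤ κ_N·orbitDist(u)² + aλ_b(L³β)²` on the window `orbitDist ≤ D·recordDelta1` — the (N)-POINTWISE brick of «ratepack-v3» at the scales of `AnalyticRatePotInput`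
# (route `FlatTubeReduction`, crux K1 `NearFlatRatioLaw` stmt-QuantumFields-24720; seat `ym-line-ftr-p1` g14; rate twin «ratepack-v3 / frozen fibres»; R2b1 RECORD rung — no summit
# statement is proved here)

WHY (memo `Cruxes/NearFlatRatioLaw/Lines/ratepack-v3-frozen-g12.md` §8.2).  `fibreMass_pointwise_of_sandwich` (F9e) fed with `fpWeight_pointwise_eventually` (F9d) at the record scales `δ = (42D+1)β^{-1/6}`, `δg = β^{-1}`, core radius
`r = β^{-7/8}`, for a frozen profile family with support radius `R_β` (`0 < R_β`, `12|Site|R_β < β^{-1/6}`, `R_β² ≤ β^{-1}` eventually — e.g. `R_β = β^{-1/2}`), with the numerology of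
`…FibreMassRecordNumerology`; the slack `4C(r + δg²) + 96C·R²` is `≤ 104C·L²·λ_b(L³β)²`.  This is the input `m̂ = mass(u)/mass(1)` (with `κ_N = 4C`, `ε_N = aλ_b²`) of
`…DressedWeightNormalised.dressedWeight_fields_normalised` and, through `…WindowPhysExtension`, of the normalised profile's exact `hN`.
* `boGamma_nonneg'`, ★★★ `fibreMass_pointwise_record`.
HONEST FRAMING: bookkeeping; the normalised-profile package (hN with κ = 0 via `fibreMassAd_normalise` + the W-fields of the quotient dressing) is the next file; hT-rate / hST / hODpot
remain; femto rung R2b1 (RECORD label); not infinite volume, not a gap, not Clay.  No defs, no named facts, no `sorry`.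
-/

set_option autoImplicit false

noncomputable section

open MeasureTheory Filter Topology Real Module
open scoped BigOperators
open Literature.MathematicalPhysics.QuantumFieldTheory
open Literature.MathematicalPhysics.QuantumLattice

namespace Summit.QuantumFields.YangMills.Theorems.FemtoTransferGap.TwoLattice.ConstTube

open Summit.QuantumFields.YangMills.Theorems.FemtoTransferGap
open Summit.QuantumFields.YangMills.Theorems.FemtoTransferGap.TwoLattice.Avg
open Summit.QuantumFields.YangMills.Theorems.FemtoTransferGap.TwoLattice.Stiff (LinkSpace)

variable {L : ℕ} [NeZero L]

/-- `0 ≤ boGamma Ω δg N̄` for `N̄ ≥ 0`. [folklore] -/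
theorem boGamma_nonneg' (Ω : LinkSpace L → ℝ) (δg : ℝ) {Nbar : ℝ} (hN : 0 ≤ Nbar) : 0 ≤ boGamma L Ω δg Nbar := by
  unfold boGamma
  exact mul_nonneg hN (integral_nonneg fun v => by positivity)

set_option maxHeartbeats 1600000 in
/-- ★★★ **THE FIBRE MASS POINTWISE AT RATE, RECORD SCALES.**  `D ≥ 0`; a frozen profile family `Ω_β` (measurable, `|Ω_β| ≤ 1`, supported in `‖x‖ ≤ R_β`) with `0 < R_β`,
`12|Site|·R_β < β^{-1/6}` and `R_β² ≤ β^{-1}` eventually.  Then there is `M₀(L) ≥ 2` and for every `M ≥ M₀` constants `κ_N, a ≥ 0` and `β₀` such that for `β ≥ β₀` and every `u` with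
`orbitDist u ≤ D·recordDelta1 L (1/6) β` (`mass_β = fibreMass (softWeight (recordChi L (1/6) (42D+1) M β)) Ω_β`, `γ_β = recordGamma L Ω β`):
`|mass_β(u) − γ_β| ≤ (κ_N·orbitDist(u)² + a·λ_b(L³β)²)·γ_β`, and if `γ_β > 0`: `0 < mass_β(1)` and `|mass_β(u)/mass_β(1) − 1| ≤ κ_N·orbitDist(u)² + a·λ_b(L³β)²`. [cite: Luscher1983, §3] -/
theorem fibreMass_pointwise_record (hL : Nonempty (NzSite L)) {D : ℝ} (hD : 0 ≤ D) {Ω : ℝ → LinkSpace L → ℝ} {R : ℝ → ℝ}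
    (hΩm : ∀ β, Measurable (Ω β)) (hΩ1 : ∀ β x, |Ω β x| ≤ 1) (hΩR : ∀ β x, Ω β x ≠ 0 → ‖x‖ ≤ R β)
    (hR0 : ∀ᶠ β in atTop, 0 < R β) (hRsmall : ∀ᶠ β in atTop, 12 * Fintype.card (Site 3 L) * R β < powScale (1 / 6) β) (hR1 : ∀ᶠ β in atTop, R β ^ 2 ≤ powScale 1 β) :
    ∃ M₀ : ℝ, 2 ≤ M₀ ∧ ∀ M : ℝ, M₀ ≤ M → ∃ κN a β₀ : ℝ, 0 ≤ κN ∧ 0 ≤ a ∧ ∀ β : ℝ, β₀ ≤ β →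
      ∀ u : GaugeConfig 3 1 SU2, orbitDist u ≤ D * recordDelta1 L (1 / 6) β →
        |fibreMass L (softWeight (recordChi L (1 / 6) (42 * D + 1) M β)) (Ω β) u - recordGamma L Ω β| ≤
            (κN * orbitDist u ^ 2 + a * bareLambda ((L : ℝ) ^ 3 * β) ^ 2) * recordGamma L Ω β ∧
        (0 < recordGamma L Ω β →
          0 < fibreMass L (softWeight (recordChi L (1 / 6) (42 * D + 1) M β)) (Ω β) 1 ∧
          |fibreMass L (softWeight (recordChi L (1 / 6) (42 * D + 1) M β)) (Ω β) u / fibreMass L (softWeight (recordChi L (1 / 6) (42 * D + 1) M β)) (Ω β) 1 - 1| ≤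
            κN * orbitDist u ^ 2 + a * bareLambda ((L : ℝ) ^ 3 * β) ^ 2) := by
  -- the record scales
  obtain ⟨δ, hδdef⟩ : ∃ δ : ℝ → ℝ, δ = fun β => (42 * D + 1) * powScale (1 / 6) β := ⟨_, rfl⟩
  have hK1 : (1 : ℝ) ≤ 42 * D + 1 := by linarith
  have hδ0 : ∀ β, 0 < δ β := fun β => by rw [hδdef]; exact mul_pos (by linarith) (powScale_pos _ β)
  have hδt : Tendsto δ atTop (𝓝 0) := by
    rw [hδdef]; simpa using (tendsto_powScale (by norm_num : (0 : ℝ) < 1 / 6)).const_mul (42 * D + 1)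
  have hsd : ∀ᶠ β in atTop, 0 < powScale 1 β ∧ powScale 1 β ≤ δ β := Filter.Eventually.of_forall fun β => by rw [hδdef]; exact (record_scales_le hK1 β).1
  have hr : ∀ᶠ β in atTop, 0 ≤ powScale (7 / 8) β ∧ powScale (7 / 8) β ≤ δ β ^ 2 := Filter.Eventually.of_forall fun β => by rw [hδdef]; exact (record_scales_le hK1 β).2
  have hc : 0 < (1 / (4 * sliceConst L)) ^ 2 := by have := sliceConst_pos L; positivity
  have htail : ∀ᶠ β in atTop, (4 : ℝ) ^ (flatDim L / 2 : ℝ) * Real.exp (-((1 / (4 * sliceConst L)) ^ 2 * powScale (7 / 8) β ^ 2 / (4 * powScale 1 β ^ 2))) ≤ powScale (7 / 8) β :=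
    record_tail_eventually (by positivity) hc
  obtain ⟨M₀, hM₀, hmain⟩ := fpWeight_pointwise_eventually L hL (δg := powScale 1) (r := powScale (7 / 8)) hδ0 hδt hsd hr htail
  refine ⟨M₀, hM₀, fun M hM => ?_⟩
  obtain ⟨C, β₀, hC0, hpt⟩ := hmain M hM
  have hM1 : (1 : ℝ) ≤ M := by linarith
  -- the remaining eventual facts: window, `R > 0`, `δ ≤ 1/8`, the ratio smallness, `ε_N ≤ aλ²`
  have hev : ∀ᶠ β in atTop, 0 < R β ∧ (0 ≤ D * recordDelta1 L (1 / 6) β ∧ Fintype.card (Edge 3 L) * (4 * R β + D * recordDelta1 L (1 / 6) β) < δ β) ∧ δ β ≤ 1 / 8 ∧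
      C * ((powScale (7 / 8) β + powScale 1 β ^ 2) + (4 * R β) ^ 2) ≤ 1 / 2 ∧
      4 * C * (powScale (7 / 8) β + powScale 1 β ^ 2) + 96 * C * R β ^ 2 ≤ 104 * C * (L : ℝ) ^ 2 * bareLambda ((L : ℝ) ^ 3 * β) ^ 2 := by
    filter_upwards [hR0, hRsmall, hR1, hδt.eventually (eventually_le_nhds (by norm_num : (0:ℝ) < 1 / 8)),
      eventually_mul_le_of_tendsto (tendsto_powScale (by norm_num : (0 : ℝ) < 1 / 6)) (18 * C) (by norm_num : (0:ℝ) < 1 / 2),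
      record_epsN_small (L := L) hC0 hR1] with β hRβ hRs hR1β hδ8 h18 hε
    refine ⟨hRβ, by rw [hδdef]; exact record_window_lt hD hRs, hδ8, ?_, hε⟩
    have h1 := powScale_le_powScale (show (1 / 6 : ℝ) ≤ 7 / 8 by norm_num) β
    have h2 := powScale_le_powScale (show (1 / 6 : ℝ) ≤ 1 by norm_num) β
    have h3 : powScale 1 β ^ 2 ≤ powScale 1 β := by
      have := powScale_le_one (show (0 : ℝ) ≤ 1 by norm_num) β; have h0 := (powScale_pos 1 β).le; nlinarith
    have hsum : (powScale (7 / 8) β + powScale 1 β ^ 2) + (4 * R β) ^ 2 ≤ 18 * powScale (1 / 6) β := by nlinarith only [h1, h2, h3, hR1β]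
    have := mul_le_mul_of_nonneg_left hsum hC0
    linarith only [this, h18]
  obtain ⟨β₁, hβ₁⟩ := Filter.eventually_atTop.mp hev
  have hχ : ∀ β, recordChi L (1 / 6) (42 * D + 1) M β = recordWeightRho L δ (fun b => M * δ b) (powScale 1) β := fun β => by rw [hδdef]; rfl
  refine ⟨4 * C, 104 * C * (L : ℝ) ^ 2, max β₀ β₁, by positivity, by positivity, fun β hβ u hu => ?_⟩
  obtain ⟨hRβ, hw, hδ8, hκ1, hε⟩ := hβ₁ β ((le_max_right _ _).trans hβ)
  have hρ : δ β ≤ M * δ β := by nlinarith only [hM1, hδ0 β]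
  obtain ⟨hsand, hratio⟩ := fibreMass_pointwise_of_sandwich (ρ := fun b => M * δ b) (a := powScale (7 / 8) β + powScale 1 β ^ 2) hC0
    (hpt β ((le_max_left _ _).trans hβ)) (hΩm β) (hΩ1 β) (hΩR β) hRβ hw.1 hw.2 hρ hδ8 hu
  have hγ0 : 0 ≤ recordGamma L Ω β := boGamma_nonneg' (Ω β) _ (fpWeightBar_pos L (powScale_pos 1 β)).le
  have hd0 := orbitDist_nonneg u
  have hps0 := (powScale_pos (7 / 8) β).le
  -- `C(a + (4R + d)²) ≤ 4C d² + (4Ca + 96CR²) ≤ 4C d² + aλ²`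
  have hkey : C * ((powScale (7 / 8) β + powScale 1 β ^ 2) + (4 * R β + orbitDist u) ^ 2) ≤
      4 * C * orbitDist u ^ 2 + 104 * C * (L : ℝ) ^ 2 * bareLambda ((L : ℝ) ^ 3 * β) ^ 2 := by
    have hsq : (4 * R β + orbitDist u) ^ 2 ≤ 2 * ((4 * R β) ^ 2 + orbitDist u ^ 2) := by nlinarith only [sq_nonneg (4 * R β - orbitDist u)]
    have := mul_le_mul_of_nonneg_left hsq hC0
    nlinarith only [this, hε, hC0, hps0, sq_nonneg (powScale 1 β), sq_nonneg (R β), sq_nonneg (orbitDist u)]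
  rw [hχ β]
  refine ⟨hsand.trans (mul_le_mul_of_nonneg_right hkey hγ0), fun hγ => ?_⟩
  obtain ⟨hpos, hq⟩ := hratio hγ hκ1
  exact ⟨hpos, hq.trans (by linarith only [hkey, hε])⟩

end Summit.QuantumFields.YangMills.Theorems.FemtoTransferGap.TwoLattice.ConstTube

end
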